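import Literature.Analysis.FluidPDE.SwirlMaximumPrinciple
import Literature.Analysis.FluidPDE.AxisymQuotientBounds
import Literature.Analysis.FluidPDE.AxisymOmegaEnergy
import Literature.Analysis.FluidPDE.AxisymWeights
import Literature.Analysis.FluidPDE.AxisymQuotientRayAverage
import Literature.Analysis.FluidPDE.AxisymPhiFourEnergy
import HarnessLib

/-!
# The localised `L²` energy inequality of the swirl `Γ = r v^θ` (towards `‖Γ(t)‖₂ ≤ ‖Γ₀‖₂`,
# Lei–Zhang 2017, §4)

Analysis/FluidPDE proof file (theorems only; no definitions, no named facts) on the discharge path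
of the named fact `Literature.Analysis.FluidPDE.LeiZhang2017_smallSwirl_regularity`
(Lei–Zhang 2017, Thm. 1.4).

Lei–Zhang (arXiv:1505.02628, §4, p. 10) use, besides the maximum principle
`‖Γ‖_{L^∞} ≤ ‖Γ₀‖_{L^∞}` (tree: `IsTaoSolutionOn.abs_swirl_le`), the `L²` a-priori estimate

> "Recall that we have the following a priori estimate: `‖Γ‖_{L²} ≤ ‖Γ₀‖_{L²}`,
> `‖Γ‖_{L^∞} ≤ ‖Γ₀‖_{L^∞}`."

for the swirl `Γ = r v^θ = x₀v₁ − x₁v₀`, which obeys `∂ₜΓ + v·∇Γ = ΔΓ − (2/r)∂ᵣΓ` ((1.3); tree: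
`swirl_transport_holds`).  Since `Γ` carries the weight `x_h`, `Γ(t) ∈ L²` is not automatic in
Tao's class and the estimate has to be localised.  This file proves the two fixed-time inputs:

* `IsClassicalNSSolutionOn.swirl_timeDeriv_add_eq` — **the `Γ`-equation as an identity of
  smooth functions on all of `ℝ³`**: `Γ' + DΓ[v] = ν (ΔΓ − 2 ω_z)` with `Γ' = swirl (∂ₜv t)`,
  `ω_z = ∂₀v₁ − ∂₁v₀` (`(1/r)∂ᵣΓ = ω_z`, `IsAxisymmetric.partialDeriv_eR_swirl`; axis by continuity);
* `IsClassicalNSSolutionOn.integral_sqBallCutoff_mul_swirl_le` — **the localised energy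
  inequality**: with the ball cut-off `χ_R(x) = sT(2 − |x|²/R²)²` of `AxisymWeights`
  (`sT = Real.smoothTransition`, `|sT'| ≤ D`), for `ν ≥ 0`, `|v t| ≤ B`, `‖Dv t‖ ≤ B'`, `|Γ| ≤ M`,
  `∫ χ_R Γ' Γ ≤ (8 M D + 192 ν D² + 32 ν D) ∫ (1 − χ_{R/2}) |v t|²`.
  Pairing the equation with `χ_R Γ`: the transport term is `−∫ χ_RΓDΓ[v] = ∫ ψ Γ² Dψ[v]`
  (`χ_R = ψ²`, `div v = 0`), the diffusion term is
  `ν∫ χ_RΓΔΓ = −ν∫ χ_R|∇Γ|² − ν∫ Γ Dχ_R[∇Γ] ≤ (ν/4) Σᵢ ∫ Γ²(∂ᵢχ_R)²/χ_R` with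
  `‖Dχ_R‖² ≤ 32D²χ_R/R²`, and the drift term is `−2ν ∫ χ_R Γ ω_z = ν ∫ σ Dχ_R[x_h]` where
  `σ = r²Φ² = (v^θ)²`, `Φ = angVelQuot (v t)` (`Γ ω_z = Γ radDerivQuot Γ = σ + ½ Dσ[x_h]`, by parts;
  the axis term of the `L^∞`/`L²` estimates is invisible in this smooth form), `|Dχ_R[x_h]| ≤ 4Dr²/R²`.
  On the support of `Dχ_R` one has `R < |x| < √2 R`, hence `|Γ| ≤ 2|x||v| ≤ 2√2 R |v|`,
  `σ ≤ |v|²` and `1 − χ_{R/2} = 1`; with `|Γ| ≤ M` every term is `≲ ∫_{|x| > R} |v|²`.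

The time integration and the limit `R → ∞` (dominated convergence on the slab, Fatou) are the
sequel file `AxisymSwirlL2Bound.lean`.

## Mathlib / tree search

Tree: `swirl_transport_holds`, `IsAxisymmetric.partialDeriv_eR_swirl`, `timeDerivWithin_swirl`,
`fderiv_swirl_apply`, `contDiff_swirl` (`SwirlTransportProofs`),
`IsClassicalNSSolutionOn.isAxisymmetricScalar_pressure`, `isAxisymmetric_zero`
(`AxisymmetricVorticityTransport`, `SwirlMaximumPrinciple`), `IsSmoothSpaceTimeOn.timeDerivWithin_swirl_eq_swirl`
(`AxisymQuotientEquations`), `eq_of_eq_off_axis` (`AxisymQuotientBounds`),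
`integral_mul_fderiv_apply_eq_zero_of_isDivFree`, `fderiv_apply_eq_sum_three` (`AxisymOmegaEnergy`),
`IsAxisymmetric.radDerivQuot_swirl_eq`-free form via `fderiv_apply_horizontal_eq`,
`IsAxisymmetric.cylRadius_sq_mul_angVelQuot`, `IsAxisymmetric.horizSq_mul_angVelQuot_sq_le`-type bound
(reproved inline), `fderiv_sqBallCutoff_apply`, `norm_fderiv_sqBallCutoff_le'`,
`norm_fderiv_sqBallCutoff_sq_le`, `abs_horizontal_fderiv_sqBallCutoff_le`, `sqBallCutoff_*`
(`AxisymWeights`), `abs_swirl_le_norm_mul` (`LeiZhang2017AxisymmetricCriteria`),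
`Calculus.deriv_smoothTransition_of_one_le / _of_nonpos`.  Mathlib:
`integral_mul_fderiv_eq_neg_fderiv_mul_of_integrable`, `Continuous.integrable_of_hasCompactSupport`,
`Continuous.memLp_of_hasCompactSupport`, `HasCompactSupport.fderiv_apply`.

## References

* Z. Lei, Q. S. Zhang, Pacific J. Math. 289 (2017) 169–187, arXiv:1505.02628, §1 (1.3)–(1.4),
  §4 p. 10 ("`‖Γ‖_{L²} ≤ ‖Γ₀‖_{L²}`"). [`LeiZhang2017`]
* D. Chae, J. Lee, Math. Z. 239 (2002), 645–671, §3 (the `L^p` estimates of `Γ`). [folklore]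
-/

noncomputable section

open MeasureTheory Set Function Filter Topology InnerProductSpace WithLp
open scoped RealInnerProductSpace Laplacian ContDiff ENNReal

namespace Literature.Analysis.FluidPDE

/-! ### The `Γ`-equation on all of `ℝ³` -/

section GammaEquation

variable {S : Set ℝ} {ν : ℝ} {v : ℝ → EuclideanSpace ℝ (Fin 3) → EuclideanSpace ℝ (Fin 3)}
  {q : ℝ → EuclideanSpace ℝ (Fin 3) → ℝ}

/-- **The swirl equation as an identity of smooth functions** (Lei–Zhang 2017, (1.3); KNSS 2009,
(1.8)): for a classical solution of the unforced system with viscosity `ν` on a time set `S` of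
unique differentiability with axisymmetric velocity, at every `t ∈ S` and EVERY `x`,
`Γ'(x) + DΓ(x)[v] = ν (ΔΓ(x) − 2 ω_z(x))`, `Γ = swirl (v t)`, `Γ' = swirl (∂ₜv t)`,
`ω_z = ∂₀v₁ − ∂₁v₀` (off the axis `(2/r)∂ᵣΓ = 2ω_z`, `swirl_transport_holds`; on the axis by
continuity). [cite: LeiZhang2017, §1 (1.3) (arXiv p. 3)] -/
theorem IsClassicalNSSolutionOn.swirl_timeDeriv_add_eq (hcl : IsClassicalNSSolutionOn S ν 0 v q)
    (hS : UniqueDiffOn ℝ S) (hax : ∀ s ∈ S, IsAxisymmetric (v s)) {t : ℝ} (ht : t ∈ S)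
    (x : EuclideanSpace ℝ (Fin 3)) :
    swirl (FluidPDE.timeDerivWithin S v t) x + fderiv ℝ (swirl (v t)) x (v t x) =
      ν * ((Δ (swirl (v t))) x - 2 * (fderiv ℝ (v t) x (EuclideanSpace.single 0 1) 1 -
        fderiv ℝ (v t) x (EuclideanSpace.single 1 1) 0)) := by
  have hsm : IsSmoothSpaceTimeOn S v := hcl.smooth_velocity
  have hv : ContDiff ℝ ∞ (v t) := hcl.contDiff_velocity ht
  have hv2 : ContDiff ℝ 2 (v t) := hv.of_le (by norm_cast)
  have hd : Differentiable ℝ (v t) := hv.differentiable (by simp)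
  have hdv : ContDiff ℝ ∞ (FluidPDE.timeDerivWithin S v t) := hsm.contDiff_timeDerivWithin_slice hS ht
  have hΓ2 : ContDiff ℝ 2 (swirl (v t)) := contDiff_swirl hv2
  have hp : ∀ s ∈ S, IsAxisymmetricScalar (q s) := fun s hs =>
    hcl.isAxisymmetricScalar_pressure hS hax (fun _ _ => isAxisymmetric_zero) hs
  have cD : ∀ (w : EuclideanSpace ℝ (Fin 3)) (i : Fin 3), Continuous fun y => fderiv ℝ (v t) y w i :=
    fun w i => (contDiff_apply_coord_vec3 (contDiff_zero.2 ((hv.continuous_fderiv (by simp)).clm_apply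
      continuous_const)) i).continuous
  have hL : Continuous fun y => swirl (FluidPDE.timeDerivWithin S v t) y +
      fderiv ℝ (swirl (v t)) y (v t y) :=
    (contDiff_swirl hdv).continuous.add ((hΓ2.continuous_fderiv (by norm_num)).clm_apply hv.continuous)
  have hR : Continuous fun y => ν * ((Δ (swirl (v t))) y - 2 * (fderiv ℝ (v t) y
      (EuclideanSpace.single 0 1) 1 - fderiv ℝ (v t) y (EuclideanSpace.single 1 1) 0)) :=
    continuous_const.mul ((continuous_laplacian hΓ2).sub (continuous_const.mul
      ((cD _ 1).sub (cD _ 0))))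
  refine eq_of_eq_off_axis hL hR (fun z hz => ?_) x
  have h := swirl_transport_holds hcl hax hp ht hz
  rw [hsm.timeDerivWithin_swirl_eq_swirl ht z, convect_apply,
    (hax t ht).partialDeriv_eR_swirl (hd z)] at h
  have h0 : swirl ((0 : ℝ → EuclideanSpace ℝ (Fin 3) → EuclideanSpace ℝ (Fin 3)) t) z = 0 := by
    simp [swirl]
  rw [h0, add_zero] at h
  rw [h]
  field_simp

end GammaEquation


/-! ### Three integrations by parts against a compactly supported weight -/

section WeightedIBP

variable {φ ψ Γ σ : EuclideanSpace ℝ (Fin 3) → ℝ} {u : EuclideanSpace ℝ (Fin 3) → EuclideanSpace ℝ (Fin 3)}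

/-- A continuous function times a continuous compactly supported one is integrable. [folklore] -/
theorem integrable_cutoff_mul_of_continuous {f g : EuclideanSpace ℝ (Fin 3) → ℝ}
    (hf : Continuous f) (hfc : HasCompactSupport f) (hg : Continuous g) :
    Integrable (fun x => f x * g x) volume :=
  (hf.mul hg).integrable_of_hasCompactSupport hfc.mul_right

/-- **Transport against a cut-off**: `∫ ψ² Γ DΓ[u] = −∫ ψ Γ² Dψ[u]` for `ψ ∈ C¹` with compact
support, `Γ ∈ C¹`, and a divergence-free `u ∈ C¹` bounded with bounded derivative
(`∫ G DG[u] = 0` for `G = ψΓ`, `integral_mul_fderiv_apply_eq_zero_of_isDivFree`). [folklore] -/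
theorem integral_sq_mul_mul_fderiv_apply_eq (hψ : ContDiff ℝ 1 ψ) (hψc : HasCompactSupport ψ)
    (hΓ : ContDiff ℝ 1 Γ) (hu : ContDiff ℝ 1 u) (hdiv : VectorCalculus.IsDivFree u)
    {B : ℝ} (hbB : ∀ x, ‖u x‖ ≤ B) {B' : ℝ} (hDb : ∀ x, ‖fderiv ℝ u x‖ ≤ B') :
    ∫ x, ψ x ^ 2 * Γ x * fderiv ℝ Γ x (u x) = -∫ x, ψ x * Γ x ^ 2 * fderiv ℝ ψ x (u x) := by
  have hG : ContDiff ℝ 1 fun x => ψ x * Γ x := hψ.mul hΓ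
  have hGc : HasCompactSupport fun x => ψ x * Γ x := hψc.mul_right
  have hψd : Differentiable ℝ ψ := hψ.differentiable one_ne_zero
  have hΓd : Differentiable ℝ Γ := hΓ.differentiable one_ne_zero
  have h0 : MemLp (fun x => ψ x * Γ x) 2 volume := hG.continuous.memLp_of_hasCompactSupport hGc
  have hDG : ∀ x v, fderiv ℝ (fun y => ψ y * Γ y) x v = fderiv ℝ ψ x v * Γ x + ψ x * fderiv ℝ Γ x v := by
    intro x v
    rw [fderiv_fun_mul (hψd x) (hΓd x)]
    simp only [_root_.add_apply, _root_.smul_apply, smul_eq_mul]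
    ring
  have h1 : ∀ i : Fin 3, MemLp (fun x => fderiv ℝ (fun y => ψ y * Γ y) x (EuclideanSpace.single i 1)) 2
      volume := fun i =>
    ((hG.continuous_fderiv one_ne_zero).clm_apply continuous_const).memLp_of_hasCompactSupport
      (hGc.fderiv_apply (𝕜 := ℝ) _)
  have hz := integral_mul_fderiv_apply_eq_zero_of_isDivFree hG hu hdiv h0 h1 hbB hDb
  have hpt : ∀ x, (ψ x * Γ x) * fderiv ℝ (fun y => ψ y * Γ y) x (u x) =
      ψ x ^ 2 * Γ x * fderiv ℝ Γ x (u x) + ψ x * Γ x ^ 2 * fderiv ℝ ψ x (u x) := by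
    intro x; rw [hDG]; ring
  have cDΓ : Continuous fun x => fderiv ℝ Γ x (u x) := (hΓ.continuous_fderiv one_ne_zero).clm_apply hu.continuous
  have cDψ : Continuous fun x => fderiv ℝ ψ x (u x) := (hψ.continuous_fderiv one_ne_zero).clm_apply hu.continuous
  have iA : Integrable (fun x => ψ x ^ 2 * Γ x * fderiv ℝ Γ x (u x)) volume :=
    (integrable_cutoff_mul_of_continuous hψ.continuous hψc
      ((hψ.continuous.mul hΓ.continuous).mul cDΓ)).congr (ae_of_all _ fun x => by simp only [Pi.mul_apply]; ring)
  have iB : Integrable (fun x => ψ x * Γ x ^ 2 * fderiv ℝ ψ x (u x)) volume :=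
    (integrable_cutoff_mul_of_continuous hψ.continuous hψc
      ((hΓ.continuous.pow 2).mul cDψ)).congr (ae_of_all _ fun x => by simp only [Pi.mul_apply, Pi.pow_apply]; ring)
  rw [integral_congr_ae (ae_of_all _ hpt), integral_add iA iB] at hz
  linarith

/-- **Diffusion against a cut-off, per coordinate**: `∫ φ Γ ∂ᵢ∂ᵢΓ = −∫ (∂ᵢφ Γ + φ ∂ᵢΓ) ∂ᵢΓ` for
`φ ∈ C¹` with compact support and `Γ ∈ C²`. [folklore] -/
theorem integral_mul_mul_fderiv_fderiv_apply_eq (hφ : ContDiff ℝ 1 φ) (hφc : HasCompactSupport φ)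
    (hΓ : ContDiff ℝ 2 Γ) (i : Fin 3) :
    ∫ x, φ x * Γ x * fderiv ℝ (fun y => fderiv ℝ Γ y (EuclideanSpace.single i 1)) x
        (EuclideanSpace.single i 1) =
      -∫ x, (fderiv ℝ φ x (EuclideanSpace.single i 1) * Γ x +
        φ x * fderiv ℝ Γ x (EuclideanSpace.single i 1)) * fderiv ℝ Γ x (EuclideanSpace.single i 1) := by
  set e : EuclideanSpace ℝ (Fin 3) := EuclideanSpace.single i 1 with he
  have hΓ1 : ContDiff ℝ 1 Γ := hΓ.of_le (by norm_num)
  have hφd : Differentiable ℝ φ := hφ.differentiable one_ne_zero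
  have hΓd : Differentiable ℝ Γ := hΓ1.differentiable one_ne_zero
  have hg1 : ContDiff ℝ 1 fun y => fderiv ℝ Γ y e := contDiff_fderiv_apply_const_succ (n := 1) (by exact_mod_cast hΓ) e
  have hgd : Differentiable ℝ fun y => fderiv ℝ Γ y e := hg1.differentiable one_ne_zero
  have hf : Differentiable ℝ fun x => φ x * Γ x := hφd.mul hΓd
  have hDf : ∀ x, fderiv ℝ (fun y => φ y * Γ y) x e = fderiv ℝ φ x e * Γ x + φ x * fderiv ℝ Γ x e := by
    intro x
    rw [fderiv_fun_mul (hφd x) (hΓd x)]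
    simp only [_root_.add_apply, _root_.smul_apply, smul_eq_mul]
    ring
  have cDφ : Continuous fun x => fderiv ℝ φ x e := (hφ.continuous_fderiv one_ne_zero).clm_apply continuous_const
  have cDΓ : Continuous fun x => fderiv ℝ Γ x e := hg1.continuous
  have cDDΓ : Continuous fun x => fderiv ℝ (fun y => fderiv ℝ Γ y e) x e :=
    (hg1.continuous_fderiv one_ne_zero).clm_apply continuous_const
  have sDφ : HasCompactSupport fun x => fderiv ℝ φ x e := hφc.fderiv_apply (𝕜 := ℝ) e
  have ifg' : Integrable (fun x => φ x * Γ x * fderiv ℝ (fun y => fderiv ℝ Γ y e) x e) volume :=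
    (integrable_cutoff_mul_of_continuous hφ.continuous hφc (hΓ.continuous.mul cDDΓ)).congr
      (ae_of_all _ fun x => by simp only [Pi.mul_apply]; ring)
  have ifg : Integrable (fun x => φ x * Γ x * fderiv ℝ Γ x e) volume :=
    (integrable_cutoff_mul_of_continuous hφ.continuous hφc (hΓ.continuous.mul cDΓ)).congr
      (ae_of_all _ fun x => by simp only [Pi.mul_apply]; ring)
  have if'g : Integrable (fun x => (fderiv ℝ φ x e * Γ x + φ x * fderiv ℝ Γ x e) * fderiv ℝ Γ x e) volume := by
    have i1 := integrable_cutoff_mul_of_continuous cDφ sDφ (hΓ.continuous.mul cDΓ)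
    have i2 := integrable_cutoff_mul_of_continuous hφ.continuous hφc (cDΓ.mul cDΓ)
    exact (i1.add i2).congr (ae_of_all _ fun x => by simp only [Pi.add_apply, Pi.mul_apply]; ring)
  have hibp := integral_mul_fderiv_eq_neg_fderiv_mul_of_integrable (μ := volume)
    (f := fun x => φ x * Γ x) (g := fun y => fderiv ℝ Γ y e) (v := e)
    (if'g.congr (ae_of_all _ fun x => by simp only [hDf x])) ifg' ifg
    (fun x _ => hf x) (fun x _ => hgd x)
  simp only [hDf] at hibp
  exact hibp

/-- **By parts against `xᵢ φ`**: `∫ φ xᵢ ∂ᵢσ = −∫ (xᵢ ∂ᵢφ + φ) σ` for `φ ∈ C¹` with compact support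
and `σ ∈ C¹` (`∂ᵢ xᵢ = 1`). [folklore] -/
theorem integral_mul_coord_mul_fderiv_apply_eq (hφ : ContDiff ℝ 1 φ) (hφc : HasCompactSupport φ)
    (hσ : ContDiff ℝ 1 σ) (i : Fin 3) :
    ∫ x, φ x * x i * fderiv ℝ σ x (EuclideanSpace.single i 1) =
      -∫ x, (x i * fderiv ℝ φ x (EuclideanSpace.single i 1) + φ x) * σ x := by
  set e : EuclideanSpace ℝ (Fin 3) := EuclideanSpace.single i 1 with he
  have hφd : Differentiable ℝ φ := hφ.differentiable one_ne_zero
  have hσd : Differentiable ℝ σ := hσ.differentiable one_ne_zero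
  have hxi : ∀ x : EuclideanSpace ℝ (Fin 3), HasFDerivAt (fun y : EuclideanSpace ℝ (Fin 3) => y i)
      (EuclideanSpace.proj (𝕜 := ℝ) i : EuclideanSpace ℝ (Fin 3) →L[ℝ] ℝ) x := fun x => by
    have h := (EuclideanSpace.proj (𝕜 := ℝ) i : EuclideanSpace ℝ (Fin 3) →L[ℝ] ℝ).hasFDerivAt (x := x)
    exact h
  have hxid : Differentiable ℝ fun y : EuclideanSpace ℝ (Fin 3) => y i := fun x => (hxi x).differentiableAt
  have hf : Differentiable ℝ fun x => φ x * x i := hφd.mul hxid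
  have hDf : ∀ x, fderiv ℝ (fun y => φ y * y i) x e = x i * fderiv ℝ φ x e + φ x := by
    intro x
    rw [fderiv_fun_mul (hφd x) (hxid x), (hxi x).fderiv]
    simp only [_root_.add_apply, _root_.smul_apply, smul_eq_mul]
    simp [he]
    ring
  have cx : Continuous fun y : EuclideanSpace ℝ (Fin 3) => y i :=
    (contDiff_piLp_apply (𝕜 := ℝ) (p := 2) (n := 0) (i := i)).continuous
  have cDφ : Continuous fun x => fderiv ℝ φ x e := (hφ.continuous_fderiv one_ne_zero).clm_apply continuous_const
  have cDσ : Continuous fun x => fderiv ℝ σ x e := (hσ.continuous_fderiv one_ne_zero).clm_apply continuous_const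
  have sDφ : HasCompactSupport fun x => fderiv ℝ φ x e := hφc.fderiv_apply (𝕜 := ℝ) e
  have ifg' : Integrable (fun x => φ x * x i * fderiv ℝ σ x e) volume :=
    (integrable_cutoff_mul_of_continuous hφ.continuous hφc (cx.mul cDσ)).congr
      (ae_of_all _ fun x => by simp only [Pi.mul_apply]; ring)
  have ifg : Integrable (fun x => φ x * x i * σ x) volume :=
    (integrable_cutoff_mul_of_continuous hφ.continuous hφc (cx.mul hσ.continuous)).congr
      (ae_of_all _ fun x => by simp only [Pi.mul_apply]; ring)
  have if'g : Integrable (fun x => (x i * fderiv ℝ φ x e + φ x) * σ x) volume := by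
    have i1 := integrable_cutoff_mul_of_continuous cDφ sDφ (cx.mul hσ.continuous)
    have i2 := integrable_cutoff_mul_of_continuous hφ.continuous hφc hσ.continuous
    exact (i1.add i2).congr (ae_of_all _ fun x => by simp only [Pi.add_apply, Pi.mul_apply]; ring)
  have hibp := integral_mul_fderiv_eq_neg_fderiv_mul_of_integrable (μ := volume)
    (f := fun x => φ x * x i) (g := σ) (v := e)
    (if'g.congr (ae_of_all _ fun x => by simp only [hDf x])) ifg' ifg
    (fun x _ => hf x) (fun x _ => hσd x)
  simp only [hDf] at hibp
  exact hibp

end WeightedIBP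

/-! ### `Γ ω_z = σ + ½ Dσ[x_h]` with `σ = r²Φ² = (v^θ)²` -/

section GammaOmega

variable {u : EuclideanSpace ℝ (Fin 3) → EuclideanSpace ℝ (Fin 3)}

/-- **`Γ · radDerivQuot Γ = σ + ½ (x₀∂₀σ + x₁∂₁σ)`** with `σ = (x₀² + x₁²) Φ²`, `Φ = angVelQuot u`,
for an axisymmetric `u ∈ C³` (`Γ = r²Φ`, `r² radDerivQuot Γ = DΓ[x_h]`): the drift term of the
`Γ`-equation is a horizontal divergence of a smooth field. [folklore] -/
theorem IsAxisymmetric.swirl_mul_radDerivQuot_swirl_eq (hax : IsAxisymmetric u) (hu : ContDiff ℝ 3 u)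
    (x : EuclideanSpace ℝ (Fin 3)) :
    swirl u x * radDerivQuot (swirl u) x =
      (x 0 ^ 2 + x 1 ^ 2) * angVelQuot u x ^ 2 +
        1 / 2 * (x 0 * fderiv ℝ (fun y : EuclideanSpace ℝ (Fin 3) => (y 0 ^ 2 + y 1 ^ 2) * angVelQuot u y ^ 2) x
          (EuclideanSpace.single 0 1) +
        x 1 * fderiv ℝ (fun y : EuclideanSpace ℝ (Fin 3) => (y 0 ^ 2 + y 1 ^ 2) * angVelQuot u y ^ 2) x
          (EuclideanSpace.single 1 1)) := by
  have hu2 : ContDiff ℝ 2 u := hu.of_le (by norm_num)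
  have hΓ2 : ContDiff ℝ 2 (swirl u) := contDiff_swirl hu2
  have hΦ1 : ContDiff ℝ 1 (angVelQuot u) := contDiff_angVelQuot (n := 1) (by exact_mod_cast hu)
  have hΦd : Differentiable ℝ (angVelQuot u) := hΦ1.differentiable one_ne_zero
  have hρd : ∀ y : EuclideanSpace ℝ (Fin 3), DifferentiableAt ℝ
      (fun y : EuclideanSpace ℝ (Fin 3) => y 0 ^ 2 + y 1 ^ 2) y := fun y => (hasFDerivAt_rho y).differentiableAt
  -- `Γ = ρ Φ`
  have hΓ : swirl u = fun y => (y 0 ^ 2 + y 1 ^ 2) * angVelQuot u y := by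
    funext y; rw [← cylRadius_sq, hax.cylRadius_sq_mul_angVelQuot hu2 y]
  -- `ρ q = x₀∂₀Γ + x₁∂₁Γ`
  have hH : (x 0 ^ 2 + x 1 ^ 2) * radDerivQuot (swirl u) x =
      x 0 * fderiv ℝ (swirl u) x (EuclideanSpace.single 0 1) +
        x 1 * fderiv ℝ (swirl u) x (EuclideanSpace.single 1 1) := by
    have h := fderiv_apply_horizontal_eq hΓ2 hax.isAxisymmetricScalar_swirl x
    rw [map_add, map_smul, map_smul, smul_eq_mul, smul_eq_mul, cylRadius_sq] at h
    rw [← h]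
  -- derivatives of `Γ = ρΦ` and `σ = ρΦ²`
  have hDΓ : ∀ v, fderiv ℝ (swirl u) x v =
      2 * (x 0 * v 0 + x 1 * v 1) * angVelQuot u x + (x 0 ^ 2 + x 1 ^ 2) * fderiv ℝ (angVelQuot u) x v := by
    intro v
    rw [hΓ, fderiv_fun_mul (hρd x) (hΦd x)]
    simp only [_root_.add_apply, _root_.smul_apply, smul_eq_mul, fderiv_rho_apply]
    ring
  have hΦ2d : DifferentiableAt ℝ (fun y => angVelQuot u y ^ 2) x := (hΦd x).pow 2
  have hDσ : ∀ v, fderiv ℝ (fun y : EuclideanSpace ℝ (Fin 3) => (y 0 ^ 2 + y 1 ^ 2) * angVelQuot u y ^ 2) x v =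
      2 * (x 0 * v 0 + x 1 * v 1) * angVelQuot u x ^ 2 +
        (x 0 ^ 2 + x 1 ^ 2) * (2 * angVelQuot u x * fderiv ℝ (angVelQuot u) x v) := by
    intro v
    rw [fderiv_fun_mul (hρd x) hΦ2d]
    simp only [_root_.add_apply, _root_.smul_apply, smul_eq_mul, fderiv_rho_apply]
    rw [show (fun y => angVelQuot u y ^ 2) = fun y => angVelQuot u y ^ 2 from rfl,
      ((hΦd x).hasFDerivAt.pow 2).fderiv]
    simp only [_root_.FunLike.coe_smul, Pi.smul_apply, smul_eq_mul]
    ring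
  have hΓx : swirl u x = (x 0 ^ 2 + x 1 ^ 2) * angVelQuot u x := by rw [hΓ]
  calc swirl u x * radDerivQuot (swirl u) x
      = angVelQuot u x * ((x 0 ^ 2 + x 1 ^ 2) * radDerivQuot (swirl u) x) := by rw [hΓx]; ring
    _ = angVelQuot u x * (x 0 * fderiv ℝ (swirl u) x (EuclideanSpace.single 0 1) +
        x 1 * fderiv ℝ (swirl u) x (EuclideanSpace.single 1 1)) := by rw [hH]
    _ = _ := by
        rw [hDΓ, hDΓ, hDσ, hDσ]
        simp
        ring

end GammaOmega

/-! ### The ball profile `ψ_R = sT(2 − |x|²/R²)` and its derivative -/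

section Profile

/-- **Derivative of the ball profile** `ψ_R(y) = sT(2 − |y|²/R²)`:
`Dψ_R(x) h = sT'(2 − |x|²/R²) · (−2⟪x, h⟫/R²)`. [folklore] -/
theorem fderiv_ballProfile_apply (R : ℝ) (x h : EuclideanSpace ℝ (Fin 3)) :
    fderiv ℝ (fun y : EuclideanSpace ℝ (Fin 3) => Real.smoothTransition (2 - ‖y‖ ^ 2 / R ^ 2)) x h =
      deriv Real.smoothTransition (2 - ‖x‖ ^ 2 / R ^ 2) * (-(2 * ⟪x, h⟫) / R ^ 2) := by
  have hs : HasFDerivAt (fun y : EuclideanSpace ℝ (Fin 3) => 2 - ‖y‖ ^ 2 / R ^ 2)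
      (-((R ^ 2)⁻¹ • (2 • innerSL ℝ x))) x := by
    have h1 := ((hasStrictFDerivAt_norm_sq x).hasFDerivAt.const_mul (R ^ 2)⁻¹).const_sub 2
    have heq : (fun y : EuclideanSpace ℝ (Fin 3) => 2 - ‖y‖ ^ 2 / R ^ 2) =
        fun y => 2 - (R ^ 2)⁻¹ * ‖y‖ ^ 2 := funext fun y => by ring
    rw [heq]; exact h1
  have hg := (Calculus.differentiable_smoothTransition _).hasDerivAt.comp_hasFDerivAt x hs
  have hg' : HasFDerivAt (fun y : EuclideanSpace ℝ (Fin 3) => Real.smoothTransition (2 - ‖y‖ ^ 2 / R ^ 2))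
      _ x := hg
  rw [hg'.fderiv]
  simp [innerSL_apply_apply]
  ring

/-- The derivative of the ball profile vanishes off the shell `R² < |x|² < 2R²`. [folklore] -/
theorem fderiv_ballProfile_eq_zero {R : ℝ} (hR : 0 < R) {x : EuclideanSpace ℝ (Fin 3)}
    (hx : ‖x‖ ^ 2 ≤ R ^ 2 ∨ 2 * R ^ 2 ≤ ‖x‖ ^ 2) :
    fderiv ℝ (fun y : EuclideanSpace ℝ (Fin 3) => Real.smoothTransition (2 - ‖y‖ ^ 2 / R ^ 2)) x = 0 := by
  ext h
  rw [fderiv_ballProfile_apply, _root_.zero_apply]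
  rcases hx with hx | hx
  · have h1 : 1 ≤ 2 - ‖x‖ ^ 2 / R ^ 2 := by
      have : ‖x‖ ^ 2 / R ^ 2 ≤ 1 := by rw [div_le_one (by positivity)]; exact hx
      linarith
    rw [Calculus.deriv_smoothTransition_of_one_le h1, zero_mul]
  · have h1 : 2 - ‖x‖ ^ 2 / R ^ 2 ≤ 0 := by
      have : 2 ≤ ‖x‖ ^ 2 / R ^ 2 := by rw [le_div_iff₀ (by positivity)]; exact hx
      linarith
    rw [Calculus.deriv_smoothTransition_of_nonpos h1, zero_mul]

/-- On the shell: if `Dψ_R(x) ≠ 0` then `R² < |x|² < 2R²`. [folklore] -/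
theorem shell_of_fderiv_ballProfile_ne_zero {R : ℝ} (hR : 0 < R) {x : EuclideanSpace ℝ (Fin 3)}
    (hx : fderiv ℝ (fun y : EuclideanSpace ℝ (Fin 3) => Real.smoothTransition (2 - ‖y‖ ^ 2 / R ^ 2)) x ≠ 0) :
    R ^ 2 < ‖x‖ ^ 2 ∧ ‖x‖ ^ 2 < 2 * R ^ 2 := by
  by_contra h
  rw [not_and_or, not_lt, not_lt] at h
  exact hx (fderiv_ballProfile_eq_zero hR h)

/-- **Size of the derivative of the ball profile**: `‖Dψ_R(x)‖ ≤ 2√2 D / R` (`|sT'| ≤ D`). [folklore] -/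
theorem norm_fderiv_ballProfile_le {D : ℝ} (hD : ∀ t, |deriv Real.smoothTransition t| ≤ D)
    {R : ℝ} (hR : 0 < R) (x : EuclideanSpace ℝ (Fin 3)) :
    ‖fderiv ℝ (fun y : EuclideanSpace ℝ (Fin 3) => Real.smoothTransition (2 - ‖y‖ ^ 2 / R ^ 2)) x‖ ≤
      2 * Real.sqrt 2 * D / R := by
  have hD0 : 0 ≤ D := (abs_nonneg _).trans (hD 0)
  by_cases hz : fderiv ℝ (fun y : EuclideanSpace ℝ (Fin 3) => Real.smoothTransition (2 - ‖y‖ ^ 2 / R ^ 2)) x = 0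
  · rw [hz, norm_zero]; positivity
  obtain ⟨-, h2⟩ := shell_of_fderiv_ballProfile_ne_zero hR hz
  have hxR : ‖x‖ ≤ Real.sqrt 2 * R := by
    have h0 : 0 ≤ Real.sqrt 2 * R := by positivity
    refine le_of_pow_le_pow_left₀ two_ne_zero h0 ?_
    rw [mul_pow, Real.sq_sqrt (by norm_num : (0:ℝ) ≤ 2)]
    exact h2.le
  refine ContinuousLinearMap.opNorm_le_bound _ (by positivity) fun h => ?_
  rw [fderiv_ballProfile_apply, Real.norm_eq_abs, abs_mul, abs_div, abs_neg, abs_mul,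
    abs_of_pos (by norm_num : (0:ℝ) < 2), abs_of_pos (by positivity : 0 < R ^ 2)]
  have h1 := hD (2 - ‖x‖ ^ 2 / R ^ 2)
  have h3 : |⟪x, h⟫| ≤ ‖x‖ * ‖h‖ := abs_real_inner_le_norm x h
  calc |deriv Real.smoothTransition (2 - ‖x‖ ^ 2 / R ^ 2)| * (2 * |⟪x, h⟫| / R ^ 2)
      ≤ D * (2 * (Real.sqrt 2 * R * ‖h‖) / R ^ 2) := by
        gcongr
        exact h3.trans (mul_le_mul_of_nonneg_right hxR (norm_nonneg _))
    _ = 2 * Real.sqrt 2 * D / R * ‖h‖ := by field_simp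

/-- If the derivative of the squared cut-off `χ_R = ψ_R²` does not vanish then `R² < |x|² < 2R²`.
[folklore] -/
theorem shell_of_fderiv_sqBallCutoff_ne_zero {R : ℝ} (hR : 0 < R) {x : EuclideanSpace ℝ (Fin 3)}
    (hx : fderiv ℝ (fun y : EuclideanSpace ℝ (Fin 3) => Real.smoothTransition (2 - ‖y‖ ^ 2 / R ^ 2) ^ 2) x ≠ 0) :
    R ^ 2 < ‖x‖ ^ 2 ∧ ‖x‖ ^ 2 < 2 * R ^ 2 := by
  by_contra h
  rw [not_and_or, not_lt, not_lt] at h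
  apply hx
  ext v
  rw [fderiv_sqBallCutoff_apply, _root_.zero_apply]
  rcases h with h | h
  · have h1 : 1 ≤ 2 - ‖x‖ ^ 2 / R ^ 2 := by
      have : ‖x‖ ^ 2 / R ^ 2 ≤ 1 := by rw [div_le_one (by positivity)]; exact h
      linarith
    rw [Calculus.deriv_smoothTransition_of_one_le h1]; ring
  · have h1 : 2 - ‖x‖ ^ 2 / R ^ 2 ≤ 0 := by
      have : 2 ≤ ‖x‖ ^ 2 / R ^ 2 := by rw [le_div_iff₀ (by positivity)]; exact h
      linarith
    rw [Real.smoothTransition.zero_of_nonpos h1]; ring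

/-- On the shell of `χ_R` the inner cut-off `χ_{R/2}` vanishes: `1 − χ_{R/2}(x) = 1` if `R² < |x|²`.
[folklore] -/
theorem sqBallCutoff_half_eq_zero {R : ℝ} (hR : 0 < R) {x : EuclideanSpace ℝ (Fin 3)}
    (hx : R ^ 2 < ‖x‖ ^ 2) : Real.smoothTransition (2 - ‖x‖ ^ 2 / (R / 2) ^ 2) ^ 2 = 0 :=
  sqBallCutoff_eq_zero (by positivity) (by nlinarith)

/-- AM–GM with the squared-cut-off property: if `c² ≤ K φ`, `0 ≤ φ`, `0 ≤ K`, then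
`−c g a ≤ φ a² + (K/4) g²`. [folklore] -/
theorem neg_mul_mul_le_of_sq_le {φ c g a K : ℝ} (hφ : 0 ≤ φ) (hK : 0 ≤ K) (hc : c ^ 2 ≤ K * φ) :
    -(c * g * a) ≤ φ * a ^ 2 + K / 4 * g ^ 2 := by
  rcases eq_or_lt_of_le hφ with hφ0 | hφpos
  · have hc0 : c = 0 := by
      rw [← hφ0, mul_zero] at hc
      exact pow_eq_zero_iff (n := 2) two_ne_zero |>.1 (le_antisymm hc (sq_nonneg c))
    rw [hc0]; simp only [zero_mul, neg_zero]; positivity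
  · have key : 0 ≤ 4 * φ * (φ * a ^ 2 + K / 4 * g ^ 2 + c * g * a) := by
      nlinarith [sq_nonneg (2 * φ * a + c * g), mul_nonneg (sub_nonneg.2 hc) (sq_nonneg g)]
    have : 0 ≤ φ * a ^ 2 + K / 4 * g ^ 2 + c * g * a := by
      by_contra hneg
      push Not at hneg
      nlinarith
    linarith

end Profile

/-! ### The localised energy inequality -/

section LocalisedEnergy

variable {S : Set ℝ} {ν : ℝ} {v : ℝ → EuclideanSpace ℝ (Fin 3) → EuclideanSpace ℝ (Fin 3)}
  {q : ℝ → EuclideanSpace ℝ (Fin 3) → ℝ}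

/-- **The localised `L²` energy inequality of the swirl** (the fixed-time computation behind
Lei–Zhang's "`‖Γ‖_{L²} ≤ ‖Γ₀‖_{L²}`", §4 p. 10): for a classical solution of the unforced system with
viscosity `ν ≥ 0` on a time set `S` of unique differentiability with axisymmetric velocity, at
`t ∈ S`, if `v t ∈ L²`, `|v t| ≤ B`, `‖Dv t‖ ≤ B'`, `|Γ| ≤ M` (`Γ = swirl (v t)`) and `|sT'| ≤ D`,
then for every `R > 0`, with `χ_R(x) = sT(2 − |x|²/R²)²`,
`∫ χ_R · swirl (∂ₜv t) · Γ ≤ (8MD + 192νD² + 32νD) ∫ (1 − χ_{R/2}) |v t|²`.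
[cite: LeiZhang2017, §4 (p. 10), "‖Γ‖_{L²} ≤ ‖Γ₀‖_{L²}"] -/
theorem IsClassicalNSSolutionOn.integral_sqBallCutoff_mul_swirl_le
    (hcl : IsClassicalNSSolutionOn S ν 0 v q) (hS : UniqueDiffOn ℝ S)
    (hax : ∀ s ∈ S, IsAxisymmetric (v s)) (hν : 0 ≤ ν) {t : ℝ} (ht : t ∈ S)
    (hL2 : MemLp (v t) 2 volume)
    {B : ℝ} (hbB : ∀ x, ‖v t x‖ ≤ B) {B' : ℝ} (hDb : ∀ x, ‖fderiv ℝ (v t) x‖ ≤ B')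
    {M : ℝ} (hM : ∀ x, |swirl (v t) x| ≤ M)
    {D : ℝ} (hD : ∀ s, |deriv Real.smoothTransition s| ≤ D) {R : ℝ} (hR : 0 < R) :
    ∫ x, Real.smoothTransition (2 - ‖x‖ ^ 2 / R ^ 2) ^ 2 *
        (swirl (FluidPDE.timeDerivWithin S v t) x * swirl (v t) x) ≤
      (8 * M * D + 192 * ν * D ^ 2 + 32 * ν * D) *
        ∫ x, (1 - Real.smoothTransition (2 - ‖x‖ ^ 2 / (R / 2) ^ 2) ^ 2) * ‖v t x‖ ^ 2 := by
  -- names: the profile `ψ`, the inner tail weight, the basis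
  obtain ⟨ψ, hψ_def⟩ : ∃ ψ : EuclideanSpace ℝ (Fin 3) → ℝ,
      ψ = fun y => Real.smoothTransition (2 - ‖y‖ ^ 2 / R ^ 2) := ⟨_, rfl⟩
  have hψx : ∀ y : EuclideanSpace ℝ (Fin 3), Real.smoothTransition (2 - ‖y‖ ^ 2 / R ^ 2) = ψ y :=
    fun y => by rw [hψ_def]
  obtain ⟨χ₂, hχ_def⟩ : ∃ χ₂ : EuclideanSpace ℝ (Fin 3) → ℝ,
      χ₂ = fun y => Real.smoothTransition (2 - ‖y‖ ^ 2 / (R / 2) ^ 2) ^ 2 := ⟨_, rfl⟩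
  have hχx : ∀ y : EuclideanSpace ℝ (Fin 3), Real.smoothTransition (2 - ‖y‖ ^ 2 / (R / 2) ^ 2) ^ 2 = χ₂ y :=
    fun y => by rw [hχ_def]
  simp only [hψx, hχx]
  set e : Fin 3 → EuclideanSpace ℝ (Fin 3) := fun i => EuclideanSpace.single i 1 with he
  have he' : ∀ i, EuclideanSpace.single i (1 : ℝ) = e i := fun i => rfl
  -- regularity of the flow at time `t`
  have hsm : IsSmoothSpaceTimeOn S v := hcl.smooth_velocity
  have hv : ContDiff ℝ ∞ (v t) := hcl.contDiff_velocity ht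
  have hv3 : ContDiff ℝ 3 (v t) := hv.of_le (by norm_cast)
  have hv2 : ContDiff ℝ 2 (v t) := hv.of_le (by norm_cast)
  have hv1 : ContDiff ℝ 1 (v t) := hv.of_le (by norm_cast)
  have hdv : ContDiff ℝ ∞ (FluidPDE.timeDerivWithin S v t) := hsm.contDiff_timeDerivWithin_slice hS ht
  have hΓ2 : ContDiff ℝ 2 (swirl (v t)) := contDiff_swirl hv2
  have hΓ1 : ContDiff ℝ 1 (swirl (v t)) := contDiff_swirl hv1
  have cΓ : Continuous (swirl (v t)) := hΓ1.continuous
  have cΓ' : Continuous (swirl (FluidPDE.timeDerivWithin S v t)) := (contDiff_swirl hdv).continuous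
  have cDΓ : ∀ w, Continuous fun x => fderiv ℝ (swirl (v t)) x w := fun w =>
    (hΓ1.continuous_fderiv one_ne_zero).clm_apply continuous_const
  have hg1 : ∀ i, ContDiff ℝ 1 fun y => fderiv ℝ (swirl (v t)) y (e i) := fun i =>
    contDiff_fderiv_apply_const_succ (n := 1) (by exact_mod_cast hΓ2) _
  have cDDΓ : ∀ i, Continuous fun x => fderiv ℝ (fun y => fderiv ℝ (swirl (v t)) y (e i)) x (e i) :=
    fun i => ((hg1 i).continuous_fderiv one_ne_zero).clm_apply continuous_const
  have hΦ1 : ContDiff ℝ 1 (angVelQuot (v t)) := contDiff_angVelQuot (n := 1) (by exact_mod_cast hv3)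
  have hq0 : Continuous (radDerivQuot (swirl (v t))) := continuous_radDerivQuot hΓ2
  -- the profile and the cut-off
  have hψ : ContDiff ℝ 1 ψ := by
    rw [hψ_def]
    exact Real.smoothTransition.contDiff.comp (contDiff_const.sub ((contDiff_norm_sq ℝ).div_const _))
  have hψd : Differentiable ℝ ψ := hψ.differentiable one_ne_zero
  have hψ0 : ∀ x, 0 ≤ ψ x := fun x => by rw [hψ_def]; exact Real.smoothTransition.nonneg _
  have hψ1 : ∀ x, ψ x ≤ 1 := fun x => by rw [hψ_def]; exact Real.smoothTransition.le_one _
  have hχ0 : ∀ x, 0 ≤ χ₂ x := fun x => by rw [hχ_def]; exact sq_nonneg _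
  have hχ1 : ∀ x, χ₂ x ≤ 1 := fun x => by rw [hχ_def]; exact sqBallCutoff_le_one _ _
  have hψzero : ∀ x : EuclideanSpace ℝ (Fin 3), Real.sqrt 2 * R ≤ ‖x‖ → ψ x = 0 := by
    intro x hx
    rw [hψ_def]
    have h0 : 0 ≤ Real.sqrt 2 * R := by positivity
    have h2 : 2 * R ^ 2 ≤ ‖x‖ ^ 2 := by
      calc 2 * R ^ 2 = (Real.sqrt 2 * R) ^ 2 := by rw [mul_pow, Real.sq_sqrt (by norm_num : (0:ℝ) ≤ 2)]
        _ ≤ ‖x‖ ^ 2 := pow_le_pow_left₀ h0 hx 2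
    have h : 2 ≤ ‖x‖ ^ 2 / R ^ 2 := by rwa [le_div_iff₀ (by positivity)]
    exact Real.smoothTransition.zero_of_nonpos (by linarith)
  have hψc : HasCompactSupport ψ := by
    refine HasCompactSupport.intro (isCompact_closedBall (0 : EuclideanSpace ℝ (Fin 3)) (Real.sqrt 2 * R))
      fun x hx => hψzero x ?_
    rw [Metric.mem_closedBall, dist_zero_right, not_le] at hx
    exact hx.le
  have hφ : ContDiff ℝ 1 fun y => ψ y ^ 2 := hψ.pow 2
  have hφc : HasCompactSupport fun y => ψ y ^ 2 := by
    refine HasCompactSupport.intro (isCompact_closedBall (0 : EuclideanSpace ℝ (Fin 3)) (Real.sqrt 2 * R))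
      fun x hx => ?_
    rw [Metric.mem_closedBall, dist_zero_right, not_le] at hx
    simp only [hψzero x hx.le]; ring
  have cψ : Continuous ψ := hψ.continuous
  have cφ : Continuous fun y => ψ y ^ 2 := cψ.pow 2
  have cDψ : ∀ w, Continuous fun x => fderiv ℝ ψ x w := fun w => (hψ.continuous_fderiv one_ne_zero).clm_apply continuous_const
  have cDφ : ∀ w, Continuous fun x => fderiv ℝ (fun y => ψ y ^ 2) x w := fun w =>
    (hφ.continuous_fderiv one_ne_zero).clm_apply continuous_const
  -- derivative facts of the cut-off
  have hD0 : 0 ≤ D := (abs_nonneg _).trans (hD 0)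
  have hM0 : 0 ≤ M := (abs_nonneg _).trans (hM 0)
  have hDφ : ∀ x w, fderiv ℝ (fun y => ψ y ^ 2) x w = 2 * ψ x * fderiv ℝ ψ x w := by
    intro x w
    rw [((hψd x).hasFDerivAt.pow 2).fderiv]
    simp only [_root_.FunLike.coe_smul, Pi.smul_apply, smul_eq_mul]
    ring
  have hshellψ : ∀ x, fderiv ℝ ψ x ≠ 0 → R ^ 2 < ‖x‖ ^ 2 ∧ ‖x‖ ^ 2 < 2 * R ^ 2 := fun x hx =>
    shell_of_fderiv_ballProfile_ne_zero hR (by simpa only [hψ_def] using hx)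
  have hshellφ : ∀ x, fderiv ℝ (fun y => ψ y ^ 2) x ≠ 0 → R ^ 2 < ‖x‖ ^ 2 ∧ ‖x‖ ^ 2 < 2 * R ^ 2 := by
    intro x hx
    refine hshellψ x fun h => hx ?_
    ext w
    rw [hDφ, h]; simp
  have hnDψ : ∀ x, ‖fderiv ℝ ψ x‖ ≤ 2 * Real.sqrt 2 * D / R := fun x => by
    simpa only [hψ_def] using norm_fderiv_ballProfile_le hD hR x
  have hnDφsq : ∀ x, ‖fderiv ℝ (fun y => ψ y ^ 2) x‖ ^ 2 ≤ 32 * D ^ 2 / R ^ 2 * ψ x ^ 2 := fun x => by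
    simpa only [hψ_def] using norm_fderiv_sqBallCutoff_sq_le hD hR x
  have hhor : ∀ x : EuclideanSpace ℝ (Fin 3), |x 0 * fderiv ℝ (fun y => ψ y ^ 2) x (e 0) +
      x 1 * fderiv ℝ (fun y => ψ y ^ 2) x (e 1)| ≤ 4 * D * (x 0 ^ 2 + x 1 ^ 2) / R ^ 2 := fun x => by
    simpa only [hψ_def, he] using abs_horizontal_fderiv_sqBallCutoff_le hD R x
  have hτshell : ∀ x : EuclideanSpace ℝ (Fin 3), R ^ 2 < ‖x‖ ^ 2 → χ₂ x = 0 := fun x hx => by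
    rw [hχ_def]; exact sqBallCutoff_half_eq_zero hR hx
  -- the swirl on the shell: `Γ² ≤ 8R²|v|²`
  have hΓshell : ∀ x : EuclideanSpace ℝ (Fin 3), ‖x‖ ^ 2 < 2 * R ^ 2 → |swirl (v t) x| ≤ 2 * Real.sqrt 2 * R * ‖v t x‖ := by
    intro x hx
    have hxR : ‖x‖ ≤ Real.sqrt 2 * R := by
      have h0 : 0 ≤ Real.sqrt 2 * R := by positivity
      refine le_of_pow_le_pow_left₀ two_ne_zero h0 ?_
      rw [mul_pow, Real.sq_sqrt (by norm_num : (0:ℝ) ≤ 2)]; exact hx.le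
    calc |swirl (v t) x| ≤ 2 * ‖x‖ * ‖v t x‖ := abs_swirl_le_norm_mul _ _
      _ ≤ 2 * (Real.sqrt 2 * R) * ‖v t x‖ := by gcongr
      _ = _ := by ring
  -- the equation
  have heq : ∀ x, swirl (FluidPDE.timeDerivWithin S v t) x =
      -fderiv ℝ (swirl (v t)) x (v t x) + ν * (Δ (swirl (v t))) x -
        2 * ν * radDerivQuot (swirl (v t)) x := by
    intro x
    have h := hcl.swirl_timeDeriv_add_eq hS hax ht x
    have hq : radDerivQuot (swirl (v t)) x = fderiv ℝ (v t) x (EuclideanSpace.single 0 1) 1 -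
        fderiv ℝ (v t) x (EuclideanSpace.single 1 1) 0 := by
      rw [(hax t ht).radDerivQuot_swirl_eq hv2]; exact curl_apply_two _ _
    rw [hq]; linarith
  have hlap : ∀ x, (Δ (swirl (v t))) x = fderiv ℝ (fun y => fderiv ℝ (swirl (v t)) y (e 0)) x (e 0) +
      fderiv ℝ (fun y => fderiv ℝ (swirl (v t)) y (e 1)) x (e 1) +
      fderiv ℝ (fun y => fderiv ℝ (swirl (v t)) y (e 2)) x (e 2) := by
    intro x
    rw [laplacian_eq_sum_fderiv_fderiv (EuclideanSpace.basisFun (Fin 3) ℝ) hΓ2 x]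
    simp only [EuclideanSpace.basisFun_apply, Fin.sum_univ_three, he]
  -- integrability helpers
  have key : ∀ {g : EuclideanSpace ℝ (Fin 3) → ℝ}, Continuous g → Integrable (fun x => ψ x ^ 2 * g x) volume :=
    fun hg => integrable_cutoff_mul_of_continuous cφ hφc hg
  have keyD : ∀ (i : Fin 3) {g : EuclideanSpace ℝ (Fin 3) → ℝ}, Continuous g →
      Integrable (fun x => fderiv ℝ (fun y => ψ y ^ 2) x (e i) * g x) volume := fun i _ hg =>
    integrable_cutoff_mul_of_continuous (cDφ _) (hφc.fderiv_apply (𝕜 := ℝ) _) hg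
  -- the tail integrand is integrable
  have cχ : Continuous χ₂ := by rw [hχ_def]; exact (contDiff_sqBallCutoff (R / 2) (n := 0)).continuous
  have iu2 : Integrable (fun x => ‖v t x‖ ^ 2) volume := (memLp_two_iff_integrable_sq_norm hL2.1).1 hL2
  have iτ : Integrable (fun x => (1 - χ₂ x) * ‖v t x‖ ^ 2) volume := by
    refine iu2.bdd_mul (c := 1) (continuous_const.sub cχ).aestronglyMeasurable (ae_of_all _ fun x => ?_)
    rw [Real.norm_eq_abs, abs_le]
    constructor <;> linarith [hχ0 x, hχ1 x]
  have hτ0 : ∀ x, 0 ≤ (1 - χ₂ x) * ‖v t x‖ ^ 2 := fun x => mul_nonneg (by linarith [hχ1 x]) (sq_nonneg _)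
  set Tail : ℝ := ∫ x, (1 - χ₂ x) * ‖v t x‖ ^ 2 with hTail
  have hTail0 : 0 ≤ Tail := integral_nonneg hτ0
  ------------------------------------------------------------------
  -- (T) transport: `−∫ ψ²Γ DΓ[v] = ∫ ψ Γ² Dψ[v] ≤ 8 M D · Tail`
  ------------------------------------------------------------------
  have hT := integral_sq_mul_mul_fderiv_apply_eq hψ hψc hΓ1 hv1 (hcl.divFree t ht) hbB hDb
  have hTbound : ∫ x, ψ x * swirl (v t) x ^ 2 * fderiv ℝ ψ x (v t x) ≤ 8 * M * D * Tail := by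
    rw [hTail, ← integral_const_mul]
    refine integral_mono ?_ (iτ.const_mul _) fun x => ?_
    · exact (integrable_cutoff_mul_of_continuous cψ hψc ((cΓ.pow 2).mul
        ((hψ.continuous_fderiv one_ne_zero).clm_apply hv.continuous))).congr
        (ae_of_all _ fun x => by simp only [Pi.mul_apply, Pi.pow_apply]; ring)
    · simp only
      by_cases hz : fderiv ℝ ψ x = 0
      · rw [hz]; simp only [_root_.zero_apply, mul_zero]
        exact mul_nonneg (by positivity) (hτ0 x)
      obtain ⟨h1, h2⟩ := hshellψ x hz
      rw [hτshell x h1, sub_zero, one_mul]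
      have hG := hΓshell x h2
      have hDu : |fderiv ℝ ψ x (v t x)| ≤ 2 * Real.sqrt 2 * D / R * ‖v t x‖ :=
        (Real.norm_eq_abs _ ▸ (fderiv ℝ ψ x).le_opNorm (v t x)).trans
          (mul_le_mul_of_nonneg_right (hnDψ x) (norm_nonneg _))
      have hψx' : |ψ x| ≤ 1 := by rw [abs_of_nonneg (hψ0 x)]; exact hψ1 x
      have hΓM : |swirl (v t) x| ≤ M := hM x
      calc ψ x * swirl (v t) x ^ 2 * fderiv ℝ ψ x (v t x)
          ≤ |ψ x * swirl (v t) x ^ 2 * fderiv ℝ ψ x (v t x)| := le_abs_self _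
        _ = |ψ x| * (|swirl (v t) x| * |swirl (v t) x|) * |fderiv ℝ ψ x (v t x)| := by
            rw [abs_mul, abs_mul, abs_pow, sq]
        _ ≤ 1 * (M * (2 * Real.sqrt 2 * R * ‖v t x‖)) * (2 * Real.sqrt 2 * D / R * ‖v t x‖) := by
            gcongr
        _ = 8 * M * D * ‖v t x‖ ^ 2 * (Real.sqrt 2 ^ 2 / 2) := by field_simp; ring
        _ = 8 * M * D * ‖v t x‖ ^ 2 := by rw [Real.sq_sqrt (by norm_num : (0:ℝ) ≤ 2)]; ring
  ------------------------------------------------------------------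
  -- (L) diffusion: `ν Σᵢ ∫ ψ²Γ ∂ᵢ∂ᵢΓ ≤ 192 ν D² · Tail`
  ------------------------------------------------------------------
  have hL : ∀ i, ∫ x, ψ x ^ 2 * swirl (v t) x *
      fderiv ℝ (fun y => fderiv ℝ (swirl (v t)) y (e i)) x (e i) =
      -∫ x, (fderiv ℝ (fun y => ψ y ^ 2) x (e i) * swirl (v t) x +
        ψ x ^ 2 * fderiv ℝ (swirl (v t)) x (e i)) * fderiv ℝ (swirl (v t)) x (e i) := fun i => by
    have h := integral_mul_mul_fderiv_fderiv_apply_eq hφ hφc hΓ2 i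
    simpa only [he] using h
  -- pointwise: `−∂ᵢφ Γ ∂ᵢΓ ≤ φ (∂ᵢΓ)² + 64 D² τ |v|²`
  have hLpt : ∀ i x, -(fderiv ℝ (fun y => ψ y ^ 2) x (e i) * swirl (v t) x * fderiv ℝ (swirl (v t)) x (e i)) ≤
      ψ x ^ 2 * fderiv ℝ (swirl (v t)) x (e i) ^ 2 + 64 * D ^ 2 * ((1 - χ₂ x) * ‖v t x‖ ^ 2) := by
    intro i x
    by_cases hz : fderiv ℝ (fun y => ψ y ^ 2) x = 0
    · rw [hz]; simp only [_root_.zero_apply, zero_mul, neg_zero]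
      exact add_nonneg (by positivity) (mul_nonneg (by positivity) (hτ0 x))
    obtain ⟨h1, h2⟩ := hshellφ x hz
    rw [hτshell x h1, sub_zero, one_mul]
    have hc : fderiv ℝ (fun y => ψ y ^ 2) x (e i) ^ 2 ≤ 32 * D ^ 2 / R ^ 2 * ψ x ^ 2 := by
      have h3 : |fderiv ℝ (fun y => ψ y ^ 2) x (e i)| ≤ ‖fderiv ℝ (fun y => ψ y ^ 2) x‖ := by
        have := (fderiv ℝ (fun y => ψ y ^ 2) x).le_opNorm (e i)
        rw [Real.norm_eq_abs] at this
        refine this.trans ?_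
        simp [he]
      calc fderiv ℝ (fun y => ψ y ^ 2) x (e i) ^ 2 ≤ ‖fderiv ℝ (fun y => ψ y ^ 2) x‖ ^ 2 := by
            rw [← sq_abs]; exact pow_le_pow_left₀ (abs_nonneg _) h3 2
        _ ≤ _ := hnDφsq x
    have hAM := neg_mul_mul_le_of_sq_le (sq_nonneg (ψ x)) (by positivity : (0:ℝ) ≤ 32 * D ^ 2 / R ^ 2)
      (g := swirl (v t) x) (a := fderiv ℝ (swirl (v t)) x (e i)) hc
    have hG := hΓshell x h2
    have hG2 : swirl (v t) x ^ 2 ≤ 8 * R ^ 2 * ‖v t x‖ ^ 2 := by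
      have h0 : 0 ≤ 2 * Real.sqrt 2 * R * ‖v t x‖ := by positivity
      calc swirl (v t) x ^ 2 = |swirl (v t) x| ^ 2 := (sq_abs _).symm
        _ ≤ (2 * Real.sqrt 2 * R * ‖v t x‖) ^ 2 := pow_le_pow_left₀ (abs_nonneg _) hG 2
        _ = 8 * R ^ 2 * ‖v t x‖ ^ 2 * (Real.sqrt 2 ^ 2 / 2) := by ring
        _ = _ := by rw [Real.sq_sqrt (by norm_num : (0:ℝ) ≤ 2)]; ring
    have hK : 32 * D ^ 2 / R ^ 2 / 4 * swirl (v t) x ^ 2 ≤ 64 * D ^ 2 * ‖v t x‖ ^ 2 := by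
      calc 32 * D ^ 2 / R ^ 2 / 4 * swirl (v t) x ^ 2 ≤ 32 * D ^ 2 / R ^ 2 / 4 * (8 * R ^ 2 * ‖v t x‖ ^ 2) :=
            mul_le_mul_of_nonneg_left hG2 (by positivity)
        _ = 64 * D ^ 2 * ‖v t x‖ ^ 2 := by field_simp; ring
    linarith
  -- integrate and sum
  have hLsum : ν * ((∫ x, ψ x ^ 2 * swirl (v t) x * fderiv ℝ (fun y => fderiv ℝ (swirl (v t)) y (e 0)) x (e 0)) +
      (∫ x, ψ x ^ 2 * swirl (v t) x * fderiv ℝ (fun y => fderiv ℝ (swirl (v t)) y (e 1)) x (e 1)) +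
      ∫ x, ψ x ^ 2 * swirl (v t) x * fderiv ℝ (fun y => fderiv ℝ (swirl (v t)) y (e 2)) x (e 2)) ≤
      ν * (192 * D ^ 2 * Tail) := by
    refine mul_le_mul_of_nonneg_left ?_ hν
    -- per coordinate: `Lᵢ ≤ -∫ φ(∂ᵢΓ)² + (∫ φ(∂ᵢΓ)² + 64D² Tail) = 64 D² Tail`
    have hLi : ∀ i, ∫ x, ψ x ^ 2 * swirl (v t) x * fderiv ℝ (fun y => fderiv ℝ (swirl (v t)) y (e i)) x (e i) ≤
        64 * D ^ 2 * Tail := by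
      intro i
      rw [hL i]
      have iA : Integrable (fun x => -(fderiv ℝ (fun y => ψ y ^ 2) x (e i) * swirl (v t) x *
          fderiv ℝ (swirl (v t)) x (e i))) volume :=
        ((keyD i (cΓ.mul (cDΓ _))).neg).congr (ae_of_all _ fun x => by
          simp only [Pi.neg_apply, Pi.mul_apply]; ring)
      have iB : Integrable (fun x => ψ x ^ 2 * fderiv ℝ (swirl (v t)) x (e i) ^ 2) volume :=
        (key ((cDΓ (e i)).pow 2)).congr (ae_of_all _ fun x => by simp only [Pi.pow_apply])
      have iC : Integrable (fun x => ψ x ^ 2 * fderiv ℝ (swirl (v t)) x (e i) ^ 2 +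
          64 * D ^ 2 * ((1 - χ₂ x) * ‖v t x‖ ^ 2)) volume := iB.add (iτ.const_mul _)
      have hmono := integral_mono iA iC (hLpt i)
      rw [integral_neg, integral_add iB (iτ.const_mul _), integral_const_mul] at hmono
      -- the integral of `(∂ᵢφ Γ + φ∂ᵢΓ)∂ᵢΓ` splits
      have iP1 : Integrable (fun x => fderiv ℝ (fun y => ψ y ^ 2) x (e i) * swirl (v t) x *
          fderiv ℝ (swirl (v t)) x (e i)) volume :=
        (keyD i (cΓ.mul (cDΓ _))).congr (ae_of_all _ fun x => by simp only [Pi.mul_apply]; ring)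
      have hsplit : ∫ x, (fderiv ℝ (fun y => ψ y ^ 2) x (e i) * swirl (v t) x +
          ψ x ^ 2 * fderiv ℝ (swirl (v t)) x (e i)) * fderiv ℝ (swirl (v t)) x (e i) =
          (∫ x, fderiv ℝ (fun y => ψ y ^ 2) x (e i) * swirl (v t) x * fderiv ℝ (swirl (v t)) x (e i)) +
          ∫ x, ψ x ^ 2 * fderiv ℝ (swirl (v t)) x (e i) ^ 2 := by
        rw [← integral_add iP1 iB]
        exact integral_congr_ae (ae_of_all _ fun x => by simp only; ring)
      rw [hsplit]
      linarith
    have h0 := hLi 0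
    have h1 := hLi 1
    have h2 := hLi 2
    linarith
  ------------------------------------------------------------------
  -- (Q) drift: `−2ν ∫ ψ²Γ radDerivQuot Γ = ν ∫ (x₀∂₀φ + x₁∂₁φ) σ ≤ 32 ν D · Tail`
  ------------------------------------------------------------------
  set σ : EuclideanSpace ℝ (Fin 3) → ℝ := fun y => (y 0 ^ 2 + y 1 ^ 2) * angVelQuot (v t) y ^ 2 with hσ_def
  have hσ1 : ContDiff ℝ 1 σ := contDiff_horizSq.mul (hΦ1.pow 2)
  have cσ : Continuous σ := hσ1.continuous
  have hσ0 : ∀ x, 0 ≤ σ x := fun x => by simp only [hσ_def]; positivity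
  have hΓσ : ∀ x : EuclideanSpace ℝ (Fin 3), (x 0 ^ 2 + x 1 ^ 2) * σ x = swirl (v t) x ^ 2 := by
    intro x
    have h := (hax t ht).cylRadius_sq_mul_angVelQuot hv2 x
    rw [cylRadius_sq] at h
    simp only [hσ_def]; rw [← h]; ring
  have hq : ∀ x, swirl (v t) x * radDerivQuot (swirl (v t)) x =
      σ x + 1 / 2 * (x 0 * fderiv ℝ σ x (e 0) + x 1 * fderiv ℝ σ x (e 1)) := fun x => by
    simpa only [hσ_def, he] using (hax t ht).swirl_mul_radDerivQuot_swirl_eq hv3 x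
  have hQ0 := integral_mul_coord_mul_fderiv_apply_eq hφ hφc hσ1 0
  have hQ1 := integral_mul_coord_mul_fderiv_apply_eq hφ hφc hσ1 1
  simp only [he'] at hQ0 hQ1
  have hQ : ∫ x, ψ x ^ 2 * (swirl (v t) x * radDerivQuot (swirl (v t)) x) =
      -(1 / 2) * ∫ x, (x 0 * fderiv ℝ (fun y => ψ y ^ 2) x (e 0) +
        x 1 * fderiv ℝ (fun y => ψ y ^ 2) x (e 1)) * σ x := by
    have cx : ∀ i : Fin 3, Continuous fun y : EuclideanSpace ℝ (Fin 3) => y i := fun i =>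
      (contDiff_piLp_apply (𝕜 := ℝ) (p := 2) (n := 0) (i := i)).continuous
    have iS : Integrable (fun x => ψ x ^ 2 * σ x) volume := key cσ
    have iX : ∀ i, Integrable (fun x => ψ x ^ 2 * x i * fderiv ℝ σ x (e i)) volume := fun i =>
      (key ((cx i).mul ((hσ1.continuous_fderiv one_ne_zero).clm_apply continuous_const))).congr
        (ae_of_all _ fun x => by simp only [Pi.mul_apply]; ring)
    have hexp : ∀ x, ψ x ^ 2 * (swirl (v t) x * radDerivQuot (swirl (v t)) x) =
        ψ x ^ 2 * σ x + 1 / 2 * (ψ x ^ 2 * x 0 * fderiv ℝ σ x (e 0)) +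
          1 / 2 * (ψ x ^ 2 * x 1 * fderiv ℝ σ x (e 1)) := fun x => by rw [hq x]; ring
    rw [integral_congr_ae (ae_of_all _ hexp),
      integral_add_three iS ((iX 0).const_mul _) ((iX 1).const_mul _), integral_const_mul,
      integral_const_mul, hQ0, hQ1]
    have iY : ∀ i : Fin 3, Integrable (fun x => x i * fderiv ℝ (fun y => ψ y ^ 2) x (e i) * σ x) volume :=
      fun i => (keyD i ((cx i).mul cσ)).congr (ae_of_all _ fun x => by simp only [Pi.mul_apply]; ring)
    have hs0 : ∫ x, (x 0 * fderiv ℝ (fun y => ψ y ^ 2) x (e 0) + ψ x ^ 2) * σ x =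
        (∫ x, x 0 * fderiv ℝ (fun y => ψ y ^ 2) x (e 0) * σ x) + ∫ x, ψ x ^ 2 * σ x := by
      rw [← integral_add (iY 0) iS]; exact integral_congr_ae (ae_of_all _ fun x => by simp only; ring)
    have hs1 : ∫ x, (x 1 * fderiv ℝ (fun y => ψ y ^ 2) x (e 1) + ψ x ^ 2) * σ x =
        (∫ x, x 1 * fderiv ℝ (fun y => ψ y ^ 2) x (e 1) * σ x) + ∫ x, ψ x ^ 2 * σ x := by
      rw [← integral_add (iY 1) iS]; exact integral_congr_ae (ae_of_all _ fun x => by simp only; ring)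
    have hs2 : ∫ x, (x 0 * fderiv ℝ (fun y => ψ y ^ 2) x (e 0) +
        x 1 * fderiv ℝ (fun y => ψ y ^ 2) x (e 1)) * σ x =
        (∫ x, x 0 * fderiv ℝ (fun y => ψ y ^ 2) x (e 0) * σ x) +
          ∫ x, x 1 * fderiv ℝ (fun y => ψ y ^ 2) x (e 1) * σ x := by
      rw [← integral_add (iY 0) (iY 1)]; exact integral_congr_ae (ae_of_all _ fun x => by simp only; ring)
    rw [hs0, hs1, hs2]
    ring
  have hQbound : -(2 * ν) * ∫ x, ψ x ^ 2 * (swirl (v t) x * radDerivQuot (swirl (v t)) x) ≤ ν * (32 * D * Tail) := by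
    rw [hQ]
    have hpt : ∀ x, (x 0 * fderiv ℝ (fun y => ψ y ^ 2) x (e 0) + x 1 * fderiv ℝ (fun y => ψ y ^ 2) x (e 1)) * σ x ≤
        32 * D * ((1 - χ₂ x) * ‖v t x‖ ^ 2) := by
      intro x
      by_cases hz : fderiv ℝ (fun y => ψ y ^ 2) x = 0
      · rw [hz]; simp only [_root_.zero_apply, mul_zero, zero_add, zero_mul]
        exact mul_nonneg (by positivity) (hτ0 x)
      obtain ⟨h1, h2⟩ := hshellφ x hz
      rw [hτshell x h1, sub_zero, one_mul]
      have hG2 : swirl (v t) x ^ 2 ≤ 8 * R ^ 2 * ‖v t x‖ ^ 2 := by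
        have hG := hΓshell x h2
        calc swirl (v t) x ^ 2 = |swirl (v t) x| ^ 2 := (sq_abs _).symm
          _ ≤ (2 * Real.sqrt 2 * R * ‖v t x‖) ^ 2 := pow_le_pow_left₀ (abs_nonneg _) hG 2
          _ = 8 * R ^ 2 * ‖v t x‖ ^ 2 * (Real.sqrt 2 ^ 2 / 2) := by ring
          _ = _ := by rw [Real.sq_sqrt (by norm_num : (0:ℝ) ≤ 2)]; ring
      calc (x 0 * fderiv ℝ (fun y => ψ y ^ 2) x (e 0) + x 1 * fderiv ℝ (fun y => ψ y ^ 2) x (e 1)) * σ x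
          ≤ |x 0 * fderiv ℝ (fun y => ψ y ^ 2) x (e 0) + x 1 * fderiv ℝ (fun y => ψ y ^ 2) x (e 1)| * σ x :=
            mul_le_mul_of_nonneg_right (le_abs_self _) (hσ0 x)
        _ ≤ 4 * D * (x 0 ^ 2 + x 1 ^ 2) / R ^ 2 * σ x := mul_le_mul_of_nonneg_right (hhor x) (hσ0 x)
        _ = 4 * D / R ^ 2 * swirl (v t) x ^ 2 := by rw [← hΓσ x]; ring
        _ ≤ 4 * D / R ^ 2 * (8 * R ^ 2 * ‖v t x‖ ^ 2) := mul_le_mul_of_nonneg_left hG2 (by positivity)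
        _ = 32 * D * ‖v t x‖ ^ 2 := by field_simp; ring
    have cx : ∀ i : Fin 3, Continuous fun y : EuclideanSpace ℝ (Fin 3) => y i := fun i =>
      (contDiff_piLp_apply (𝕜 := ℝ) (p := 2) (n := 0) (i := i)).continuous
    have iY : ∀ i : Fin 3, Integrable (fun x => x i * fderiv ℝ (fun y => ψ y ^ 2) x (e i) * σ x) volume :=
      fun i => (keyD i ((cx i).mul cσ)).congr (ae_of_all _ fun x => by simp only [Pi.mul_apply]; ring)
    have iL : Integrable (fun x => (x 0 * fderiv ℝ (fun y => ψ y ^ 2) x (e 0) +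
        x 1 * fderiv ℝ (fun y => ψ y ^ 2) x (e 1)) * σ x) volume :=
      ((iY 0).add (iY 1)).congr (ae_of_all _ fun x => by simp only [Pi.add_apply]; ring)
    have hmono := integral_mono iL (iτ.const_mul _) hpt
    rw [integral_const_mul] at hmono
    have : -(2 * ν) * (-(1 / 2) * ∫ x, (x 0 * fderiv ℝ (fun y => ψ y ^ 2) x (e 0) +
        x 1 * fderiv ℝ (fun y => ψ y ^ 2) x (e 1)) * σ x) =
        ν * ∫ x, (x 0 * fderiv ℝ (fun y => ψ y ^ 2) x (e 0) + x 1 * fderiv ℝ (fun y => ψ y ^ 2) x (e 1)) * σ x := by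
      ring
    rw [this]
    exact mul_le_mul_of_nonneg_left hmono hν
  ------------------------------------------------------------------
  -- integrate the equation against `ψ² Γ` and assemble
  ------------------------------------------------------------------
  have hpt : ∀ x, ψ x ^ 2 * (swirl (FluidPDE.timeDerivWithin S v t) x * swirl (v t) x) =
      ν * (ψ x ^ 2 * swirl (v t) x * fderiv ℝ (fun y => fderiv ℝ (swirl (v t)) y (e 0)) x (e 0) +
          ψ x ^ 2 * swirl (v t) x * fderiv ℝ (fun y => fderiv ℝ (swirl (v t)) y (e 1)) x (e 1) +
          ψ x ^ 2 * swirl (v t) x * fderiv ℝ (fun y => fderiv ℝ (swirl (v t)) y (e 2)) x (e 2)) +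
        -(2 * ν) * (ψ x ^ 2 * (swirl (v t) x * radDerivQuot (swirl (v t)) x)) -
        0 - ψ x ^ 2 * swirl (v t) x * fderiv ℝ (swirl (v t)) x (v t x) := by
    intro x
    rw [heq x, hlap x]
    ring
  have iLf : Integrable (fun x => ν * (ψ x ^ 2 * swirl (v t) x *
      fderiv ℝ (fun y => fderiv ℝ (swirl (v t)) y (e 0)) x (e 0) +
      ψ x ^ 2 * swirl (v t) x * fderiv ℝ (fun y => fderiv ℝ (swirl (v t)) y (e 1)) x (e 1) +
      ψ x ^ 2 * swirl (v t) x * fderiv ℝ (fun y => fderiv ℝ (swirl (v t)) y (e 2)) x (e 2))) volume := by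
    have iLi : ∀ i, Integrable (fun x => ψ x ^ 2 * swirl (v t) x *
        fderiv ℝ (fun y => fderiv ℝ (swirl (v t)) y (e i)) x (e i)) volume := fun i =>
      (key (cΓ.mul (cDDΓ i))).congr (ae_of_all _ fun x => by simp only [Pi.mul_apply]; ring)
    exact (integrable_add_three (iLi 0) (iLi 1) (iLi 2)).const_mul ν
  have iQf : Integrable (fun x => -(2 * ν) * (ψ x ^ 2 * (swirl (v t) x * radDerivQuot (swirl (v t)) x))) volume :=
    (key (cΓ.mul hq0)).const_mul _
  have iZ : Integrable (fun _ : EuclideanSpace ℝ (Fin 3) => (0 : ℝ)) volume := integrable_zero _ _ _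
  have iTf : Integrable (fun x => ψ x ^ 2 * swirl (v t) x * fderiv ℝ (swirl (v t)) x (v t x)) volume :=
    (key (cΓ.mul ((hΓ1.continuous_fderiv one_ne_zero).clm_apply hv.continuous))).congr
      (ae_of_all _ fun x => by simp only [Pi.mul_apply]; ring)
  have iLi : ∀ i, Integrable (fun x => ψ x ^ 2 * swirl (v t) x *
      fderiv ℝ (fun y => fderiv ℝ (swirl (v t)) y (e i)) x (e i)) volume := fun i =>
    (key (cΓ.mul (cDDΓ i))).congr (ae_of_all _ fun x => by simp only [Pi.mul_apply]; ring)
  rw [integral_congr_ae (ae_of_all _ hpt), integral_add_sub_sub iLf iQf iZ iTf, integral_const_mul,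
    integral_const_mul, integral_zero, integral_add_three (iLi 0) (iLi 1) (iLi 2), hT]
  have hTb := hTbound
  nlinarith [hLsum, hQbound, hTbound, hTail0, hM0, hD0, hν]

end LocalisedEnergy

end Literature.Analysis.FluidPDE

end
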